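import Literature.NumberTheory.ComplexMultiplication.CasselmanHeckeCharacterCMStructure
import Literature.NumberTheory.ComplexMultiplication.ArtinLiftAlgebra
import Literature.NumberTheory.AdelicBaseChange.AdeleNormTrace
import HarnessLib

/-!
# The twisting multiplier of Casselman's theorem depends only on the Artin symbol `[y, k]`
# (Shimura 1998, §21.4 proof of Thm. 21.4 pp. 147–148 «c is uniquely determined by σ independently of the choice of y»)

In the proof of Thm. 21.4 [Shimura1998, pp. 147–148; held chunk p0192 L11–12] the finite `K`-idèle
`t(y, b) = b · f(y)⁻¹` (`b = β(y)`, `τ₀ b = χ(y_𝐡)`; `f = g ∘ N_{k/K*}`, the tree's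
`reflexNormFinitePart K Φ K* ∘ ideleRelNorm K* k`) attached to an idèle `y` lifting `σ ∈ Aut(ℂ/k)`
(«`σ = [y, k]` on `k_ab`», `IsArtinLift`) depends only on `σ`.  The `h21` line states this as the stub
`stub_twistIdeleIndependent` (a2b v3: two Artin lifts `y, y'` of THE SAME `σ ∈ Aut(ℂ/k)` give the same
`t`).  This file converts that `Aut(ℂ/k)`-form into the **`Gal(k^ab/k)`-form** wanted by class field
theory (continuity of `σ ↦ c_σ`, A-p02's `CasselmanTwistCharacterContinuous`): two idèles with the same
Artin symbol `[y, k] = [y', k]` give the same `t` — because every element of `Gal(k^ab/k)` lifts to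
`Gal(k̄/k)` and then extends to an automorphism of `ℂ` (`ArtinLiftAlgebra.exists_algEquiv_apply_embedding_eq`,
extension of automorphisms from the countable `k̄` to `ℂ`), of which both `y` and `y'` are Artin lifts.

* `twist_eq_of_ideleArtinMap_eq` — the `Gal(k^ab/k)`-form from the `Aut(ℂ/k)`-form;
* `exists_isArtinLift_of_idele` — every idèle `y` is an Artin lift of SOME `σ ∈ Aut(ℂ/k)`.

Everything is proved; no definition, no named fact.  Cell `hodgecm-mathlib`, line `a2b`, support for
`stub_finiteLevelReciprocity` (adapter input (A3)).

## References

* [Shimura1998] G. Shimura, *Abelian Varieties with Complex Multiplication and Modular Functions* (1998),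
  §21.4 proof of Thm. 21.4 pp. 147–148; §18.3 p. 122.
-/

noncomputable section

open scoped NumberField nonZeroDivisors
open NumberField

namespace Literature.NumberTheory.ComplexMultiplication

open Literature.NumberTheory.GaloisRepresentations
open Literature.NumberTheory.NumberFields (ideleArtinMap)
open Literature.NumberTheory.AdelicBaseChange (ideleRelNorm)
open Literature.AlgebraicGeometry.Motives (CMType)
open IsDedekindDomain

variable {k : Type} [Field k] [NumberField k] [Algebra k ℂ]

/-- **Every idèle `y` of `k` is an Artin lift of some `σ ∈ Aut(ℂ/k)`**: lift `[y, k] ∈ Gal(k^ab/k)` to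
`γ ∈ Gal(k̄/k)` and extend `γ` to `ℂ` along an embedding `k̄ → ℂ`.
[cite: Shimura1998, §18.3 p. 122 («a canonical homomorphism of M_𝐀^× onto Gal(M_ab/M)»)] -/
theorem exists_isArtinLift_of_idele (y : ideleGroup k) : ∃ σ : ℂ ≃ₐ[k] ℂ, IsArtinLift k y σ := by
  obtain ⟨γ, hγ⟩ := QuotientGroup.mk'_surjective _ (ideleArtinMap k y)
  obtain ⟨σ, hσ⟩ := exists_algEquiv_apply_embedding_eq (IsAlgClosed.lift (M := ℂ)) γ
  exact ⟨σ, IsAlgClosed.lift, γ, fun x ↦ (hσ x).symm, hγ⟩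

variable {K : Type} [Field K] [NumberField K] (Φ : CMType K) (τ₀ : K →+* ℂ) (χ : HeckeCharacter k)
  [NumberField ↥(traceField Φ)] [Algebra ↥(traceField Φ) k]

/-- **«`c` is uniquely determined by `σ` independently of the choice of `y`», `Gal(k^ab/k)`-form**:
if two Artin lifts of one `σ ∈ Aut(ℂ/k)` always carry the same multiplier `t(y,b) = b·f(y)⁻¹` (the
`Aut(ℂ/k)`-form, hypothesis `hindep` = stub `stub_twistIdeleIndependent` of the `h21` line), then two
idèles with the same ARTIN SYMBOL `[y, k] = [y', k]` carry the same multiplier (both lift a common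
`σ`: `exists_isArtinLift_of_idele`, `IsArtinLift.of_ideleArtinMap_eq`).
[cite: Shimura1998, §21.4, proof of Thm. 21.4 (pp. 147–148) («c is uniquely determined by σ independently of the choice of y»)] -/
theorem twist_eq_of_ideleArtinMap_eq
    (hindep : ∀ (σ : ℂ ≃ₐ[k] ℂ) (y y' : ideleGroup k), IsArtinLift k y σ → IsArtinLift k y' σ →
      ∀ b b' : Kˣ, ((χ ((infiniteIdeles k (HeckeCharacter.infPart k y))⁻¹ * y) : ℂˣ) : ℂ) = τ₀ (b : K) →
        ((χ ((infiniteIdeles k (HeckeCharacter.infPart k y'))⁻¹ * y') : ℂˣ) : ℂ) = τ₀ (b' : K) →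
        FiniteAdeleRing.unitEmbedding (𝓞 K) K b *
            (reflexNormFinitePart K Φ (traceField Φ) (ideleRelNorm (↥(traceField Φ)) k y))⁻¹ =
          FiniteAdeleRing.unitEmbedding (𝓞 K) K b' *
            (reflexNormFinitePart K Φ (traceField Φ) (ideleRelNorm (↥(traceField Φ)) k y'))⁻¹)
    (y y' : ideleGroup k) (hyy' : ideleArtinMap k y = ideleArtinMap k y') (b b' : Kˣ)
    (hb : ((χ ((infiniteIdeles k (HeckeCharacter.infPart k y))⁻¹ * y) : ℂˣ) : ℂ) = τ₀ (b : K))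
    (hb' : ((χ ((infiniteIdeles k (HeckeCharacter.infPart k y'))⁻¹ * y') : ℂˣ) : ℂ) = τ₀ (b' : K)) :
    FiniteAdeleRing.unitEmbedding (𝓞 K) K b *
        (reflexNormFinitePart K Φ (traceField Φ) (ideleRelNorm (↥(traceField Φ)) k y))⁻¹ =
      FiniteAdeleRing.unitEmbedding (𝓞 K) K b' *
        (reflexNormFinitePart K Φ (traceField Φ) (ideleRelNorm (↥(traceField Φ)) k y'))⁻¹ := by
  obtain ⟨σ, hy⟩ := exists_isArtinLift_of_idele y
  exact hindep σ y y' hy (hy.of_ideleArtinMap_eq hyy') b b' hb hb'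

end Literature.NumberTheory.ComplexMultiplication

end
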